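import Summits.BirchSwinnertonDyer.BirchSwinnertonDyer.Theses.InertBadSignedBranches
import Summits.BirchSwinnertonDyer.BirchSwinnertonDyer.Theorems.InertBadSignedBranchesAssemblyOfEtaMC
import HarnessLib

/-!
# Route `InertBadSignedBranches` (rung K8) — the D92 glue item `LeafBridgeEtaK` (stmt-BirchSwinnertonDyer-19503) CLOSED BY NAME

The glue item of planner bsd-cm-plan's D92 edit (route rev 4): the rung leaf `X12.CMInertBad` from the
route's cruxes `CccOneLawOnTypeIstarZero` (C-cc-1 on the type `(p, I₀*)`, `p ≥ 5`) and `PlusMCEtaK`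
(Kobayashi 2003 §4 even main conjecture at `η` for CM good-supersingular `V`, `K_∞`-form, `p` odd —
conjecture-grade INPUT), the residuals `InertBadOffType` / `InertBadAtThree`, the named facts
`SignedReadingFacts` (Kitajima–Otsuki Main Thm 1.3 ∧ Kobayashi Thm 7.4 at `η`) and `PublishedFactsInert`.
It IS hand k8i-c41's landed bridge `InertBadOddEta.cmInertBad_of_cccOne_of_kobayashi74_of_plusMCEtaK`
(p425852, `Theorems/InertBadSignedBranchesAssemblyOfEtaMC.lean`), whose module imports the route file
and therefore cannot be cited inside `closes` — hence this by-name item, closed here in one term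
(planner template HOME/bsd-cm-plan/g15/repair/K8-19226/LeafBridgeClosingDraft.lean, SketchC rc 0; filed
by hand k8i-c2 g4). `PlusMCEtaK` (guard `p ≠ 2`) is restricted to the bridge's `5 ≤ p` binder. HONEST
LABEL: an implication between the route's own items — nothing about BSD, C-cc-1 or (C1_η) is asserted;
the cruxes 19223 / `PlusMCEtaK` and the residuals stay OPEN. [cite: Kobayashi2003, §4 (p. 8), Thm. 7.4 (p. 13)]
[cite: KitajimaOtsuki2018, Main Thm. 1.3 (arXiv:1607.03612 p. 3)]
[cite: PollackRubin2004, Theorem and the remark on Sel over ℚ(μ_{p^∞}) (p. 448)]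
-/

set_option linter.dupNamespace false

namespace Summit.BirchSwinnertonDyer.BirchSwinnertonDyer.Theorems

open Summit.BirchSwinnertonDyer.BirchSwinnertonDyer.Theses.InertBadSignedBranches in
/-- **`LeafBridgeEtaK` holds** (stmt-BirchSwinnertonDyer-19503): it is hand k8i-c41's landed bridge
`InertBadOddEta.cmInertBad_of_cccOne_of_kobayashi74_of_plusMCEtaK` (p425852), with `PlusMCEtaK`
restricted from `p ≠ 2` to the bridge's `5 ≤ p` binder and `SignedReadingFacts` split into its two
conjuncts. [cite: Kobayashi2003, §4 (p. 8), Thm. 7.4 (p. 13)] [cite: KitajimaOtsuki2018, Main Thm. 1.3 (arXiv:1607.03612 p. 3)] -/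
theorem inertBadSignedBranches_leafBridgeEtaK_proof : LeafBridgeEtaK := fun h₁ h₂ h₃ hK hR h₆ =>
  InertBadOddEta.cmInertBad_of_cccOne_of_kobayashi74_of_plusMCEtaK
    h₁ h₂ h₃ (fun p _ _hp5 K₀ _ _ _ _ η hη hη1 V _ _ _N _ _f hCM hp2 => hK p hp2 K₀ η hη hη1 V hCM) hR.1 hR.2 h₆

end Summit.BirchSwinnertonDyer.BirchSwinnertonDyer.Theorems
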